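import Mathlib

/-!
# SoloBlind kernel #201 — lattice flux and the weighted energy identity of a tight-binding chain

In mode space the deleted streak/roll chain of the steady-door construction is a
tight-binding LATTICE: site amplitudes `s m : ℂ`, nearest-neighbour hopping
`i κ_m` on the bond `(m, m+1)` (for the ideal chain `κ_m = P h(t)` up to the `√2`
normalisation of the first bond) and on-site absorption `μ_m ≥ 0` (`= K₀ m²`).
This file records, in exact form, the two algebraic facts on which every
propagation / local-decay ("radiation") estimate of architecture A5
(PLAN §109 (m)) rests:

* the LATTICE CONTINUITY EQUATION: along a solution,
  `d/dt |s_m|² = J_{m-1→m} − J_{m→m+1} − 2 μ_m |s_m|²` with the bond current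
  `J_{m→m+1} = 2 κ_m Im (conj s_m · s_{m+1})` (`latticeCurrent`);
* the WEIGHTED ENERGY IDENTITY (summation by parts): for any weights `w_m`,
  `d/dt Σ_{m<n} w_m |s_m|² = Σ_{m<n} (w_{m+1} − w_m) J_{m→m+1} − w_n J_{n-1→n} − 2 Σ_{m<n} w_m μ_m |s_m|²`,
  i.e. the growth of a weighted mass is driven only by the currents across the
  bonds where the weight changes (with `w_m = m` this is the "mean position"
  whose drift is the group-velocity transport; with `w` a cut-off it is the
  local-decay functional).

Everything is stated pointwise in time as `HasDerivAt` facts about arbitrary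
differentiable site amplitudes satisfying the chain equation at the instant `t`;
no ODE theory is needed.
-/

namespace Summit.AnomalousDissipation.AnomalousDissipation.Theorems

open Complex

/-- The bond current of the tight-binding chain from the site carrying `x` to the
site carrying `y` across a bond of hopping strength `κ`: `J = 2 κ Im (conj x · y)`. -/
noncomputable def latticeCurrent (κ : ℝ) (x y : ℂ) : ℝ :=
  2 * κ * ((starRingEnd ℂ) x * y).im

/-- The current is antisymmetric under exchanging the two sites. -/
theorem latticeCurrent_swap (κ : ℝ) (x y : ℂ) :
    latticeCurrent κ y x = - latticeCurrent κ x y := by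
  unfold latticeCurrent
  simp only [Complex.mul_im, Complex.conj_re, Complex.conj_im]
  ring

/-- A current across a bond into an empty site vanishes (used at the outer
boundary `s_n = 0` of a finite chain). -/
theorem latticeCurrent_zero_right (κ : ℝ) (x : ℂ) : latticeCurrent κ x 0 = 0 := by
  unfold latticeCurrent
  simp

/-- POINTWISE FLUX IDENTITY (pure algebra). If the velocity of the site amplitude
`z` is `dz = i (κa · a + κb · b) − μ z` (hopping from the left neighbour `a`
across a bond of strength `κa`, from the right neighbour `b` across a bond of
strength `κb`, on-site absorption `μ`), then
`2 Re (conj z · dz) = J(a → z) − J(z → b) − 2 μ |z|²`. -/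
theorem flux_identity (κa κb μ : ℝ) (a z b : ℂ) :
    2 * ((starRingEnd ℂ) z * (Complex.I * ((κa : ℂ) * a + (κb : ℂ) * b) - (μ : ℂ) * z)).re
      = latticeCurrent κa a z - latticeCurrent κb z b - 2 * μ * Complex.normSq z := by
  unfold latticeCurrent
  simp only [Complex.mul_re, Complex.mul_im, Complex.sub_re, Complex.sub_im, Complex.add_re,
    Complex.add_im, Complex.conj_re, Complex.conj_im, Complex.I_re, Complex.I_im,
    Complex.ofReal_re, Complex.ofReal_im, Complex.normSq_apply]
  ring

/-- Derivative of the real part of a complex-valued function of a real variable. -/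
theorem hasDerivAt_re_of_complex {f : ℝ → ℂ} {f' : ℂ} {t : ℝ} (hf : HasDerivAt f f' t) :
    HasDerivAt (fun u => (f u).re) f'.re t := by
  have h := Complex.reCLM.hasFDerivAt.comp_hasDerivAt t hf
  simpa [Function.comp_def] using h

/-- Derivative of the imaginary part of a complex-valued function of a real variable. -/
theorem hasDerivAt_im_of_complex {f : ℝ → ℂ} {f' : ℂ} {t : ℝ} (hf : HasDerivAt f f' t) :
    HasDerivAt (fun u => (f u).im) f'.im t := by
  have h := Complex.imCLM.hasFDerivAt.comp_hasDerivAt t hf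
  simpa [Function.comp_def] using h

/-- Derivative of the site mass `|f|² = normSq f` along any differentiable
complex-valued function: `d/dt |f|² = 2 Re (conj f · f')`. -/
theorem hasDerivAt_normSq {f : ℝ → ℂ} {f' : ℂ} {t : ℝ} (hf : HasDerivAt f f' t) :
    HasDerivAt (fun u => Complex.normSq (f u)) (2 * ((starRingEnd ℂ) (f t) * f').re) t := by
  have hre := hasDerivAt_re_of_complex hf
  have him := hasDerivAt_im_of_complex hf
  have h := (hre.mul hre).add (him.mul him)
  have e1 : (fun u => Complex.normSq (f u)) = fun u => (f u).re * (f u).re + (f u).im * (f u).im := by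
    funext u; exact Complex.normSq_apply (f u)
  have e2 : 2 * ((starRingEnd ℂ) (f t) * f').re
      = (f' ).re * (f t).re + (f t).re * f'.re + (f'.im * (f t).im + (f t).im * f'.im) := by
    simp only [Complex.mul_re, Complex.conj_re, Complex.conj_im]
    ring
  rw [e1, e2]
  exact h

/-- LATTICE CONTINUITY EQUATION at one site. If the site amplitudes `a, z, b` of three
consecutive sites are differentiable in time and `z` obeys the chain equation
`z' = i (κa a + κb b) − μ z` at the instant `t`, then
`d/dt |z|² = J(a → z) − J(z → b) − 2 μ |z|²` at `t`. -/
theorem site_mass_hasDerivAt (κa κb μ : ℝ) {a z b : ℝ → ℂ} {t : ℝ}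
    (hz : HasDerivAt z (Complex.I * ((κa : ℂ) * a t + (κb : ℂ) * b t) - (μ : ℂ) * z t) t) :
    HasDerivAt (fun u => Complex.normSq (z u))
      (latticeCurrent κa (a t) (z t) - latticeCurrent κb (z t) (b t) - 2 * μ * Complex.normSq (z t)) t := by
  have h := hasDerivAt_normSq hz
  rw [flux_identity] at h
  exact h

/-- SUMMATION BY PARTS for bond currents (pure algebra). With `J m` the current on
the bond `(m, m+1)` and `Jp m` the current on the bond `(m-1, m)` into site `m`
(`Jp 0 = 0`: nothing flows in from the left of site `0`; `Jp (m+1) = J m`), for any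
weights `w`:
`Σ_{m<n} w_m (Jp_m − J_m) = Σ_{m<n} (w_{m+1} − w_m) J_m − w_n Jp_n`. -/
theorem weighted_flux_telescope (w J Jp : ℕ → ℝ) (h0 : Jp 0 = 0) (hs : ∀ m, Jp (m + 1) = J m)
    (n : ℕ) :
    (Finset.range n).sum (fun m => w m * (Jp m - J m))
      = (Finset.range n).sum (fun m => (w (m + 1) - w m) * J m) - w n * Jp n := by
  induction n with
  | zero => simp [h0]
  | succ n ih =>
    rw [Finset.sum_range_succ, Finset.sum_range_succ, ih, hs n]
    ring

/-- WEIGHTED ENERGY IDENTITY of a finite tight-binding chain (sites `m < n`, hopping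
`κ m` on the bond `(m, m+1)`, absorption `μ m`, arbitrary real weights `w m`).
If every site amplitude is differentiable and obeys the chain equation at the instant
`t` (with the conventions `s` evaluated at the fictitious sites `n` and, through
`κp 0 = 0`, no bond to the left of site `0`), then the weighted mass
`E_w = Σ_{m<n} w_m |s_m|²` satisfies
`E_w' = Σ_{m<n} (w_{m+1} − w_m) J_m − w_n J_{n-1→n} − 2 Σ_{m<n} w_m μ_m |s_m|²`,
`J_m = 2 κ_m Im(conj s_m · s_{m+1})`.  Here the left bond strengths are passed as a
separate sequence `κp` with `κp 0 = 0` and `κp (m+1) = κ m`, so that the statement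
covers the half-line chain with its free end at `m = 0`. -/
theorem weighted_energy_hasDerivAt (n : ℕ) (κ κp μ w : ℕ → ℝ) (s : ℕ → ℝ → ℂ) (t : ℝ)
    (hκ0 : κp 0 = 0) (hκs : ∀ m, κp (m + 1) = κ m)
    (hs : ∀ m ∈ Finset.range n,
      HasDerivAt (s m) (Complex.I * ((κp m : ℂ) * s (m - 1) t + (κ m : ℂ) * s (m + 1) t)
        - (μ m : ℂ) * s m t) t) :
    HasDerivAt (fun u => (Finset.range n).sum (fun m => w m * Complex.normSq (s m u)))
      ((Finset.range n).sum (fun m => (w (m + 1) - w m) * latticeCurrent (κ m) (s m t) (s (m + 1) t))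
        - w n * latticeCurrent (κp n) (s (n - 1) t) (s n t)
        - 2 * (Finset.range n).sum (fun m => w m * μ m * Complex.normSq (s m t))) t := by
  -- each site: d/dt (w_m |s_m|²) = w_m (Jp_m − J_m − 2 μ_m |s_m|²)
  have hsite : ∀ m ∈ Finset.range n, HasDerivAt (fun u => w m * Complex.normSq (s m u))
      (w m * (latticeCurrent (κp m) (s (m - 1) t) (s m t) - latticeCurrent (κ m) (s m t) (s (m + 1) t)
        - 2 * μ m * Complex.normSq (s m t))) t := by
    intro m hm
    exact (site_mass_hasDerivAt (κp m) (κ m) (μ m) (hs m hm)).const_mul (w m)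
  have hsum0 := HasDerivAt.sum hsite
  have hsum : HasDerivAt (fun u => (Finset.range n).sum (fun m => w m * Complex.normSq (s m u)))
      ((Finset.range n).sum (fun m => w m * (latticeCurrent (κp m) (s (m - 1) t) (s m t)
        - latticeCurrent (κ m) (s m t) (s (m + 1) t) - 2 * μ m * Complex.normSq (s m t)))) t := by
    have e0 : (fun u => (Finset.range n).sum (fun m => w m * Complex.normSq (s m u)))
        = (Finset.range n).sum (fun m => fun u => w m * Complex.normSq (s m u)) := by
      funext u; simp [Finset.sum_apply]
    rw [e0]; exact hsum0
  -- rearrange the derivative value by the telescoping identity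
  have key : (Finset.range n).sum (fun m => w m * (latticeCurrent (κp m) (s (m - 1) t) (s m t)
        - latticeCurrent (κ m) (s m t) (s (m + 1) t) - 2 * μ m * Complex.normSq (s m t)))
      = (Finset.range n).sum (fun m => (w (m + 1) - w m) * latticeCurrent (κ m) (s m t) (s (m + 1) t))
        - w n * latticeCurrent (κp n) (s (n - 1) t) (s n t)
        - 2 * (Finset.range n).sum (fun m => w m * μ m * Complex.normSq (s m t)) := by
    have tel := weighted_flux_telescope w (fun m => latticeCurrent (κ m) (s m t) (s (m + 1) t))
      (fun m => latticeCurrent (κp m) (s (m - 1) t) (s m t)) (by simp [hκ0, latticeCurrent])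
      (by intro m; simp [hκs]) n
    have split : (Finset.range n).sum (fun m => w m * (latticeCurrent (κp m) (s (m - 1) t) (s m t)
        - latticeCurrent (κ m) (s m t) (s (m + 1) t) - 2 * μ m * Complex.normSq (s m t)))
        = (Finset.range n).sum (fun m => w m * (latticeCurrent (κp m) (s (m - 1) t) (s m t)
            - latticeCurrent (κ m) (s m t) (s (m + 1) t)))
          - 2 * (Finset.range n).sum (fun m => w m * μ m * Complex.normSq (s m t)) := by
      rw [Finset.mul_sum, ← Finset.sum_sub_distrib]
      refine Finset.sum_congr rfl ?_
      intro m _; ring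
    rw [split, tel]
  rw [← key]
  exact hsum

/-- COROLLARY (mass balance of the whole finite chain): with unit weights the total mass
`Σ_{m<n} |s_m|²` changes only through the current across the last bond and the
absorption: `d/dt Σ |s_m|² = − J_{n-1→n} − 2 Σ μ_m |s_m|²` (for the physically closed
chain `s_n = 0` the boundary current vanishes by `latticeCurrent_zero_right`). -/
theorem total_mass_hasDerivAt (n : ℕ) (κ κp μ : ℕ → ℝ) (s : ℕ → ℝ → ℂ) (t : ℝ)
    (hκ0 : κp 0 = 0) (hκs : ∀ m, κp (m + 1) = κ m)
    (hs : ∀ m ∈ Finset.range n,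
      HasDerivAt (s m) (Complex.I * ((κp m : ℂ) * s (m - 1) t + (κ m : ℂ) * s (m + 1) t)
        - (μ m : ℂ) * s m t) t) :
    HasDerivAt (fun u => (Finset.range n).sum (fun m => Complex.normSq (s m u)))
      (- latticeCurrent (κp n) (s (n - 1) t) (s n t)
        - 2 * (Finset.range n).sum (fun m => μ m * Complex.normSq (s m t))) t := by
  have h := weighted_energy_hasDerivAt n κ κp μ (fun _ => (1 : ℝ)) s t hκ0 hκs hs
  simpa using h

end Summit.AnomalousDissipation.AnomalousDissipation.Theorems
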